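import Summits.ResolutionOfSingularities.ResolutionOfSingularities.Theorems.FrobeniusLadderFRationalResolutionCoarseningEtale
import Summits.ResolutionOfSingularities.ResolutionOfSingularities.Theorems.FrobeniusLadderFRationalResolutionHomogeneousUnits
import Mathlib.RingTheory.Flat.Basic
import Mathlib.RingTheory.IntegralClosure.Algebra.Basic
import HarnessLib

/-!
# Crux `FrobeniusLadder.FRationalResolution` (stmt-ResolutionOfSingularities-15317), line `redirect`,
# stub `stub_diagonalizableQuotientResolution` — the Kummer cover `S₀ ⊆ S^{(B)}` is FINITE FREE on
# homogeneous units, with NO tameness hypothesis (brick W3' of memo MEMO-15317-leafhand2-g4 §2ter,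
# module structure of the descent)

`S` graded by `A`, `S'` the grading coarsened along `f : A → A'` with kernel `B`
(`S'_c = ⨆_{f a = c} S_a`, so `S'_0 = ⊕_{b ∈ B} S_b ⊇ S_0`), and ANY algebra structure
`S_0 → S'_0` compatible with the two inclusions into `S`. If `B` is finite and every `b ∈ B` carries
a homogeneous UNIT `u_b` of `S`, then `(u_b)_{b ∈ B}` is an `S_0`-basis of `S'_0` (independence by
projecting a relation to the `A`-degrees, spanning by the `A`-decomposition) — the linear algebra of
`…CoarseningEtale.exists_ringHom_etale_finite` WITHOUT its hypothesis `|B| ∈ S^×`, so that it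
serves the wild (inseparable) case: `S'_0` is free, finite, flat and integral over `S_0`.

* `exists_basis_of_units` — the basis of units;
* `free_of_units`, `finite_of_units`, `flat_of_units`, `isIntegral_of_units` — consequences.

Honest label: brick of the wild non-fixed route (no stub closed). No definitions, no named facts,
no sorry. [folklore; cite: SGA3, Exp. VIII §4–5]
-/

noncomputable section

-- single-problem summit: the doubled namespace component is forced
set_option linter.dupNamespace false

open DirectSum

namespace Summit.ResolutionOfSingularities.ResolutionOfSingularities.Theorems.FRationalResolution.KummerCoverBasis

universe u v w w'

variable {k : Type u} [CommRing k] {A : Type w} [DecidableEq A] [AddCommGroup A] {S : Type v}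
  [CommRing S] [Algebra k S] (𝒮 : A → Submodule k S) [GradedAlgebra 𝒮]
  {A' : Type w'} [DecidableEq A'] [AddCommGroup A'] (f : A →+ A')
  (𝒮' : A' → Submodule k S) [GradedAlgebra 𝒮']
  (h𝒮' : ∀ c, 𝒮' c = ⨆ a ∈ {a : A | f a = c}, 𝒮 a)
  [Algebra (𝒮 0) (𝒮' 0)] (halg : ∀ x, (algebraMap (𝒮 0) (𝒮' 0) x : S) = x)

include h𝒮' halg in
/-- **The Kummer cover is free on homogeneous units.** For the grading coarsened along `f` with
finite kernel `B` and homogeneous units `u_b ∈ S_b` (`b ∈ B`), there is an `S_0`-basis of `S'_0`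
consisting of homogeneous units of `S` of the degrees `b ∈ B`.
[folklore; cite: SGA3, Exp. VIII §4–5] -/
theorem exists_basis_of_units (B : AddSubgroup A) (hker : ∀ a, f a = 0 ↔ a ∈ B) [Finite B]
    (hunits : ∀ b ∈ B, ∃ u ∈ 𝒮 b, IsUnit u) :
    ∃ basis : Module.Basis B (𝒮 0) (𝒮' 0),
      ∀ b : B, ((basis b : 𝒮' 0) : S) ∈ 𝒮 (b : A) ∧ IsUnit ((basis b : 𝒮' 0) : S) := by
  -- adapted from `…CoarseningEtale.exists_ringHom_etale_finite` (no `|B| ∈ S^×` needed here)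
  classical
  have hsmul : ∀ (r : 𝒮 0) (y : 𝒮' 0), ((r • y : 𝒮' 0) : S) = (r : S) * (y : S) := by
    intro r y
    rw [Algebra.smul_def]
    change ((algebraMap (𝒮 0) (𝒮' 0) r : 𝒮' 0) : S) * (y : S) = _
    rw [halg]
  have hmemB : ∀ b : B, f (b : A) = 0 := fun b => (hker b).2 b.2
  choose u hu huunit using fun b : B => hunits (b : A) b.2
  have hv : ∀ b : B, ∃ v ∈ 𝒮 (-(b : A)), u b * v = 1 := by
    intro b
    obtain ⟨v, hv⟩ := (huunit b).exists_right_inv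
    exact ⟨v, HomogeneousUnits.inv_mem_of_isUnit 𝒮 (hu b) hv, hv⟩
  choose v hvmem hv using hv
  let e : B → 𝒮' 0 := fun b => ⟨u b, CoarseningEtale.le_coarse_zero 𝒮 f 𝒮' h𝒮' (hmemB b) (hu b)⟩
  have he : ∀ b, (e b : S) = u b := fun b => rfl
  have hpiece : ∀ (b : B) (t : S), t ∈ 𝒮 (b : A) → ∃ r ∈ 𝒮 0, t = r * u b := fun b t ht =>
    (HomogeneousUnits.mem_grade_iff_exists_mul_unit 𝒮 (hu b) (hv b) t).mp ht
  -- linear independence: project a relation to the `A`-degrees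
  have hli : LinearIndependent (𝒮 0) e := by
    rw [linearIndependent_iff']
    intro s g hsum b hb
    have hsumS : ∑ c ∈ s, ((g c : S) * u c) = 0 := by
      have h : ((∑ c ∈ s, g c • e c : 𝒮' 0) : S) = 0 :=
        congrArg (fun y : 𝒮' 0 => (y : S)) hsum
      rw [show ((∑ c ∈ s, g c • e c : 𝒮' 0) : S) = ∑ c ∈ s, ((g c • e c : 𝒮' 0) : S) from
        map_sum (algebraMap (𝒮' 0) S) _ _] at h
      simpa only [hsmul, he] using h
    have hcomp : ∀ c ∈ s, (decompose 𝒮 ((g c : S) * u c) (b : A) : S) =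
        if c = b then (g b : S) * u b else 0 := by
      intro c _
      have hmem : (g c : S) * u c ∈ 𝒮 (c : A) := by
        have h := SetLike.mul_mem_graded (g c).2 (hu c)
        rwa [zero_add] at h
      by_cases hcb : c = b
      · subst hcb
        rw [if_pos rfl, decompose_of_mem_same 𝒮 hmem]
      · rw [if_neg hcb, decompose_of_mem_ne 𝒮 hmem (fun h => hcb (Subtype.ext h))]
    have hproj : ∑ c ∈ s, (decompose 𝒮 ((g c : S) * u c) (b : A) : S) = 0 := by
      have h := congrArg (GradedRing.proj 𝒮 (b : A)) hsumS
      rw [map_sum, map_zero] at h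
      simpa only [GradedRing.proj_apply] using h
    rw [Finset.sum_congr rfl hcomp, Finset.sum_ite_eq' s b, if_pos hb] at hproj
    have hgb : (g b : S) = 0 := by
      have h := congrArg (· * v b) hproj
      simpa [mul_assoc, hv b] using h
    exact Subtype.ext hgb
  -- spanning: decompose along `A`; components outside `B` vanish
  have hsp : ⊤ ≤ Submodule.span (𝒮 0) (Set.range e) := by
    rintro x -
    have hxmem : (x : S) ∈ ⨆ a ∈ {a : A | f a = 0}, 𝒮 a := by rw [← h𝒮' 0]; exact x.2
    let y : A → 𝒮' 0 := fun a =>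
      if ha : f a = 0 then ⟨(decompose 𝒮 (x : S) a : S),
        CoarseningEtale.le_coarse_zero 𝒮 f 𝒮' h𝒮' ha (decompose 𝒮 (x : S) a).2⟩ else 0
    have hyval : ∀ a, (y a : S) = (decompose 𝒮 (x : S) a : S) := by
      intro a
      by_cases ha : f a = 0
      · simp only [y, dif_pos ha]
      · simp only [y, dif_neg ha]
        rw [Coarsening.decompose_apply_eq_zero_of_mem_biSup 𝒮 hxmem ha]
        rfl
    have hx : x = ∑ a ∈ (decompose 𝒮 (x : S)).support, y a := by
      apply Subtype.ext
      rw [show ((∑ a ∈ (decompose 𝒮 (x : S)).support, y a : 𝒮' 0) : S) =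
          ∑ a ∈ (decompose 𝒮 (x : S)).support, (y a : S) from map_sum (algebraMap (𝒮' 0) S) _ _]
      simp only [hyval]
      exact (sum_support_decompose 𝒮 (x : S)).symm
    rw [hx]
    refine Submodule.sum_mem _ fun a _ => ?_
    by_cases ha : f a = 0
    · have haB : a ∈ B := (hker a).1 ha
      obtain ⟨r, hr, hra⟩ := hpiece ⟨a, haB⟩ _ (decompose 𝒮 (x : S) a).2
      have hya : y a = (⟨r, hr⟩ : 𝒮 0) • e ⟨a, haB⟩ := by
        apply Subtype.ext
        rw [hsmul, he, hyval]
        exact hra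
      rw [hya]
      exact Submodule.smul_mem _ _ (Submodule.subset_span (Set.mem_range_self _))
    · simp only [y, dif_neg ha]
      exact Submodule.zero_mem _
  refine ⟨Module.Basis.mk hli hsp, fun b => ?_⟩
  rw [Module.Basis.mk_apply hli hsp b]
  exact ⟨hu b, huunit b⟩

include h𝒮' halg in
/-- `S'_0` is a free `S_0`-module. [folklore; cite: SGA3, Exp. VIII §4–5] -/
theorem free_of_units (B : AddSubgroup A) (hker : ∀ a, f a = 0 ↔ a ∈ B) [Finite B]
    (hunits : ∀ b ∈ B, ∃ u ∈ 𝒮 b, IsUnit u) : Module.Free (𝒮 0) (𝒮' 0) := by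
  obtain ⟨basis, -⟩ := exists_basis_of_units 𝒮 f 𝒮' h𝒮' halg B hker hunits
  exact Module.Free.of_basis basis

include h𝒮' halg in
/-- `S'_0` is a finite `S_0`-module. [folklore; cite: SGA3, Exp. VIII §4–5] -/
theorem finite_of_units (B : AddSubgroup A) (hker : ∀ a, f a = 0 ↔ a ∈ B) [Finite B]
    (hunits : ∀ b ∈ B, ∃ u ∈ 𝒮 b, IsUnit u) : Module.Finite (𝒮 0) (𝒮' 0) := by
  haveI : Fintype B := Fintype.ofFinite B
  obtain ⟨basis, -⟩ := exists_basis_of_units 𝒮 f 𝒮' h𝒮' halg B hker hunits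
  exact Module.Finite.of_basis basis

include h𝒮' halg in
/-- `S'_0` is flat over `S_0`. [folklore; cite: SGA3, Exp. VIII §4–5] -/
theorem flat_of_units (B : AddSubgroup A) (hker : ∀ a, f a = 0 ↔ a ∈ B) [Finite B]
    (hunits : ∀ b ∈ B, ∃ u ∈ 𝒮 b, IsUnit u) : Module.Flat (𝒮 0) (𝒮' 0) := by
  haveI := free_of_units 𝒮 f 𝒮' h𝒮' halg B hker hunits
  infer_instance

include h𝒮' halg in
/-- `S'_0` is integral over `S_0`. [folklore; cite: SGA3, Exp. VIII §4–5] -/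
theorem isIntegral_of_units (B : AddSubgroup A) (hker : ∀ a, f a = 0 ↔ a ∈ B) [Finite B]
    (hunits : ∀ b ∈ B, ∃ u ∈ 𝒮 b, IsUnit u) : Algebra.IsIntegral (𝒮 0) (𝒮' 0) := by
  haveI := finite_of_units 𝒮 f 𝒮' h𝒮' halg B hker hunits
  exact Algebra.IsIntegral.of_finite (𝒮 0) (𝒮' 0)

end Summit.ResolutionOfSingularities.ResolutionOfSingularities.Theorems.FRationalResolution.KummerCoverBasis

end
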